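import Literature.Analysis.FluidPDE.ConstantinDirectionDissipationCalculus
import Mathlib.Analysis.SpecialFunctions.Sqrt
import Mathlib.Analysis.Calculus.Deriv.Inv
import Mathlib.Analysis.Calculus.Deriv.Mul
import Mathlib.Analysis.InnerProductSpace.Laplacian
import HarnessLib

/-!
# Dynamics of the vorticity magnitude `|ω|` and direction `ξ = ω/|ω|`
# (Galanti–Gibbon–Heritage 1997, §3; Constantin–Fefferman 1993, (10))

Analysis/FluidPDE proof file (everything PROVED; no definitions, no named facts): the pointwise
evolution equations of the vorticity MAGNITUDE `ρ = |ω|` and the vorticity DIRECTION `ξ = ω/|ω|`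
that follow from the vorticity equation, at points where `ω ≠ 0`.

B. Galanti, J. D. Gibbon, M. Heritage, *Vorticity alignment results for the three-dimensional Euler
and Navier–Stokes equations*, Nonlinearity 10 (1997) 1675–1694 = arXiv:chao-dyn/9709003, §3
"The stretching variables and the Navier–Stokes equations" (render
`paper-arxiv-chao-dyn_9709003/p0007.txt` L3–L37), verbatim (their `ω = |𝛚|`, `ξ = 𝛚/ω`,
`α = ξ·Sξ`, `D/Dt = ∂ₜ + u·∇`):

> In vorticity form the Navier–Stokes equations are `Dω_j/Dt = S_jk ω_k + νΔω_j`, and the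
> equivalent of ((const)) for the scalar vorticity `ω = |𝛚|` is `Dω/Dt = αω + ν ξ_jΔω_j`. From the
> definition `ξ = 𝛚/ω`, `Dξ_j/Dt = S_jkξ_k − αξ_j + (ν/ω)Δω_j − (ν/ω)(ξ·Δ𝛚)ξ_j`. It is convenient
> to turn derivatives of `𝛚` into derivatives of `ξ`. To achieve this we use the fact that
> `ξ_j² = 1` leading to `ξ_jΔξ_j + |∇ξ_j|² = 0`. From the relations `ω = ω_jξ_j` and `ω_j = ωξ_j`
> we have `ξ_jΔω_j = −ω|∇ξ|² + Δω`, and `Δω_j/ω = Δξ_j + 2∇(ln ω)·∇ξ_j + ξ_jΔω/ω`. Dividing … enables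
> us to rewrite ((Dξ/Dt)) as
> `Dξ_j/Dt = S_jkξ_k − αξ_j + νΔξ_j + ν|∇ξ|²ξ_j + νβ_j`, where the vector `β` has components
> `β_j = ∂_k(ln |ω|²) ∂_kξ_j`. … [This expression is not valid at stagnation points where
> `𝛚 = 0` neither is `ξ` defined at these.]

So, for the magnitude, `(∂ₜ + u·∇ − νΔ)|ω| + ν|ω||∇ξ|² = α|ω|` — the balance whose absorption
term `|ω||∇ξ|²` is Constantin's direction-dissipation density (the tree's
`DirectionDissipation.lean` and its references: Constantin 1990, SIAM Rev. 36 (1994), LNM 1871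
(2006) §4); its squared companion is Constantin–Fefferman, Indiana Univ. Math. J. 42 (1993),
p. 779, (10):
"`(∂ₜ + u(x,t)·∇ − νΔ)|ω(x,t)|² + ν|∇ω(x,t)|² = α(x,t)|ω(x,t)|²`" (render
`CF93-IUMJ42034-primary/page-05.png`; as printed, (10) drops a factor `2` on the last two terms —
the identity proved below is `(∂ₜ + u·∇ − νΔ)|ω|² + 2ν|∇ω|² = 2α|ω|²`).

## What is proved (pointwise, at one space–time point; `ℝ³ = EuclideanSpace ℝ (Fin 3)`)

Throughout, `ω : ℝ³ → ℝ³` is a slice (or `ω : ℝ → ℝ³ → ℝ³` a time-dependent field),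
`ξ = vorticityDirection ω = |ω|⁻¹ω` (the tree's junk-free direction, `Vorticity.lean`),
`|A|²_F = frobeniusNormSq A` (sum of `‖A eᵢ‖²` over the standard orthonormal basis `e` of `ℝ³`),
`Δ` is Mathlib's Laplacian, `∂ᵢf = fderiv ℝ f x eᵢ`.

*Kinematics* (first order needs `ω` differentiable at `x`, second order `ContDiffAt ℝ 2 ω x`;
always `ω x ≠ 0`):
* `fderiv_norm_apply'` — `∂_h|ω| = ⟪ξ, ∂_hω⟫`;
* `inner_vorticityDirection_fderiv_eq_zero` — `⟪ξ, ∂_hξ⟫ = 0`;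
* `fderiv_eq_norm_deriv_smul_add` — `∂_hω = (∂_h|ω|) ξ + |ω| ∂_hξ`;
* `inner_fderiv_vorticityDirection_fderiv` — `⟪∂_hξ, ∂_hω⟫ = |ω| ‖∂_hξ‖²`;
* `laplacian_norm_eq` — **`Δ|ω| = ⟪ξ, Δω⟫ + |ω| |∇ξ|²_F`** (GGH97 (Dw4));
* `laplacian_eq_norm_direction` — **`Δω = (Δ|ω|) ξ + 2 Σᵢ (∂ᵢ|ω|) ∂ᵢξ + |ω| Δξ`** (GGH97 (Dw5));
* time derivatives: `hasDerivAt_norm_of_hasDerivAt` (`∂ₜ|ω| = ⟪ξ, ∂ₜω⟫`),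
  `hasDerivAt_vorticityDirection_of_hasDerivAt` (`∂ₜξ = |ω|⁻¹(∂ₜω − ⟪ξ,∂ₜω⟫ξ)`).

*Dynamics.*  If at `(t, x)` the field satisfies a transport–diffusion–stretching equation
`∂ₜω = νΔω − (v·∇)ω + σ` (pointwise: `HasDerivAt (fun s => ω s x) (ν • Δ(ω t) x − D(ω t)(x) v + σ) t`
for a vector `v ∈ ℝ³` — the advecting velocity at `(t,x)` — and a vector `σ ∈ ℝ³` — the stretching),
then, with `ρ = |ω|`, `ξ = ω/|ω|` (`ω t x ≠ 0`, `ω t` of class `C²` near `x`):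
* `hasDerivAt_norm_of_vorticityEquation` — **magnitude**:
  `∂ₜρ = νΔρ − ∂_vρ + (⟪ξ, σ⟫ − νρ|∇ξ|²_F)`;
* `hasDerivAt_vorticityDirection_of_vorticityEquation` — **direction**:
  `∂ₜξ = νΔξ − ∂_vξ + (ρ⁻¹(σ − ⟪ξ,σ⟫ξ) + 2νρ⁻¹ Σᵢ (∂ᵢρ) ∂ᵢξ + ν|∇ξ|²_F ξ)`;
* `hasDerivAt_norm_sq_of_vorticityEquation` — **squared magnitude** (no non-vanishing needed):
  `∂ₜρ² = νΔρ² − ∂_vρ² + (2⟪ω, σ⟫ − 2ν|∇ω|²_F)`.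

*Navier–Stokes form.*  For the vorticity `ω = curl u` of a velocity field with the classical
vorticity equation at `(t,x)` in the tree's shape
(`HasDerivAt (fun s => curl (u s) x) (ν • Δ (curl (u t)) x − convect (u t) (curl (u t)) x + convect (curl (u t)) (u t) x) t`,
as delivered by `IsLerayHopfOn.vorticity_classical_of_contDiffOn`), the stretching vector is
`σ = (ω·∇)u = ∇u ω = |ω| ∇u ξ`, so `⟪ξ,σ⟫ = α|ω|` with the **stretching rate** `α = ⟪ξ, ∇u ξ⟫`
and `ρ⁻¹(σ − ⟪ξ,σ⟫ξ) = ∇u ξ − αξ` is the **tilting vector**: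
* `NavierStokes.hasDerivAt_norm_curl` — `(∂ₜ + u·∇ − νΔ)|ω| = α|ω| − ν|ω||∇ξ|²_F` (GGH97 (Dw1) with
  (Dw4));
* `NavierStokes.hasDerivAt_vorticityDirection` —
  `(∂ₜ + u·∇ − νΔ)ξ = (∇u ξ − αξ) + 2ν|ω|⁻¹Σᵢ(∂ᵢ|ω|)∂ᵢξ + ν|∇ξ|²ξ` (GGH97 (Dxi/Dt,2));
* `NavierStokes.hasDerivAt_norm_curl_sq` — CF93 (10) (with the factors `2`);
* `NavierStokes.hasDerivAt_vorticityDirection_of_tiltingFree` — if the tilting vanishes at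
  `(t,x)` (`∇u ξ = αξ`, equivalently `ω × ∇u ω = 0`), the direction solves the SOURCE-FREE drift
  harmonic-map heat flow `(∂ₜ + u·∇ − νΔ)ξ − 2ν|ω|⁻¹Σᵢ(∂ᵢ|ω|)∂ᵢξ = ν|∇ξ|²ξ`;
* `NavierStokes.hasDerivAt_norm_curl_of_stretchingFree` — if the stretching rate vanishes at
  `(t,x)` (`⟪ω, ∇u ω⟫ = 0`), `(∂ₜ + u·∇ − νΔ)|ω| = −ν|ω||∇ξ|²_F ≤ 0`;
* `cross_eq_zero_iff_apply_eq_smul` — `ω × Aω = 0 ↔ A ξ = ⟪ξ, Aξ⟫ ξ` for `ω ≠ 0` (the bridge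
  between the two spellings of "tilting-free").

## Rendering

Pointwise statements at one `(t,x)`; `ν : ℝ` arbitrary (Euler `ν = 0` included); the velocity
enters only through the vector `v = u(t,x)` in the convective derivative and through the
stretching vector `σ`, so the three "dynamics" theorems serve any transport–diffusion–stretching
equation of vorticity type (Navier–Stokes, Euler, MHD induction, passive vectors).  GGH97's `S` is
the symmetric part of `∇u`; since the antisymmetric part of `∇u` acts on `ω` as `½ω × ω = 0`, we
write `∇u ω` (`fderiv ℝ (u t) x (curl (u t) x)`, the tree's `convect (curl (u t)) (u t) x`) for
`Sω` and `⟪ξ, ∇u ξ⟫ = ⟪ξ, Sξ⟫` for `α` — identical quantities, no symmetrisation needed.  `∇(ln ω)·∇ξ_j`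
is written `|ω|⁻¹ Σᵢ (∂ᵢ|ω|) ∂ᵢξ` over the standard orthonormal basis.  Nothing is asserted at
points where `ω = 0` (there `ξ` is the junk value `0`), exactly as in print.

## Mathlib / tree search

Reused: `vorticityDirection`, `hasFDerivAt_vorticityDirection`, `fderiv_vorticityDirection_apply`
(`Vorticity.lean`, `ConstantinDirectionDissipationCalculus.lean`), `frobeniusNormSq`
(`VectorCalculus.lean`), `curl`/`curlCLM`/`convect`, Mathlib's `InnerProductSpace.laplacian`.
`lean search 'laplacian_norm|vorticityDirection.*hasDerivAt|tilting|harmonic map heat'`: the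
pointwise magnitude/direction equations are not in the tree (2026-08-27); the slice-INTEGRATED
magnitude identity with the regularised modulus `√(|ω|²+ε²)` is
`ConstantinDirectionDissipationCalculus.lean`, and the stretching-only balances of the door
family live Summits-side.  WHAT THIS IS NOT: not a regularity statement and not an estimate —
exact pointwise calculus identities for smooth fields, kernel-checked.

## References

* B. Galanti, J. D. Gibbon, M. Heritage, Nonlinearity 10 (1997) 1675–1694 =
  arXiv:chao-dyn/9709003, §3, displays (Dw2), (Dw1), (Dξ/Dt), (Dw4), (Dw5), (Dξ/Dt,2), (djdef)
  (arXiv p. 7). [`GalantiGibbonHeritage1997`]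
* P. Constantin, C. Fefferman, Indiana Univ. Math. J. 42 (1993) 775–789, p. 779, (10).
  [`ConstantinFefferman1993`]
* P. Constantin, *Geometric statistics in turbulence*, SIAM Rev. 36 (1994) 73–98 (cf.: the
  direction-dissipation density `|ω||∇ξ|²`; not held on this hub, cited through the tree's
  `DirectionDissipation.lean`). [`Constantin1994`]
-/

noncomputable section

open MeasureTheory Set Function Filter InnerProductSpace
open scoped RealInnerProductSpace Topology Laplacian Matrix

namespace Literature.Analysis.FluidPDE

namespace VorticityDirectionDynamics

/-! ### First-order kinematics of `ρ = |ω|` and `ξ = ω/|ω|` -/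

section FirstOrder

variable {ω : EuclideanSpace ℝ (Fin 3) → EuclideanSpace ℝ (Fin 3)} {x : EuclideanSpace ℝ (Fin 3)}

/-- **Derivative of the magnitude**: where `ω(x) ≠ 0` and `ω` is differentiable,
`y ↦ |ω(y)|` has derivative `h ↦ ⟪ξ(x), Dω(x) h⟫`, `ξ = ω/|ω|` (chain rule for the norm; GGH97 §3
"`ω = ω_jξ_j`"). [cite: GalantiGibbonHeritage1997, §3 (arXiv p. 7, before (Dw4))] -/
theorem hasFDerivAt_norm {ω' : EuclideanSpace ℝ (Fin 3) →L[ℝ] EuclideanSpace ℝ (Fin 3)}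
    (h : HasFDerivAt ω ω' x) (hx : ω x ≠ 0) :
    HasFDerivAt (fun y => ‖ω y‖) ((innerSL ℝ (vorticityDirection ω x)).comp ω') x := by
  have hne : ‖ω x‖ ^ 2 + (0 : ℝ) ^ 2 ≠ 0 := by
    have : 0 < ‖ω x‖ := norm_pos_iff.2 hx
    positivity
  have h1 := hasFDerivAt_regN_comp h hne
  simp only [regN_zero] at h1
  refine h1.congr_fderiv ?_
  ext v
  simp [vorticityDirection_apply]

/-- Applied form: `∂_h|ω|(x) = ⟪ξ(x), Dω(x) h⟫` for `ω(x) ≠ 0` (GGH97 §3: differentiate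
"`ω = ω_jξ_j`" using `ξ_j∂ξ_j = 0`). [cite: GalantiGibbonHeritage1997, §3 (arXiv:chao-dyn/9709003 p. 7, "ω = ω_jξ_j")] -/
theorem fderiv_norm_apply' (h : DifferentiableAt ℝ ω x) (hx : ω x ≠ 0)
    (v : EuclideanSpace ℝ (Fin 3)) :
    fderiv ℝ (fun y => ‖ω y‖) x v = ⟪vorticityDirection ω x, fderiv ℝ ω x v⟫ := by
  rw [(hasFDerivAt_norm h.hasFDerivAt hx).fderiv]
  rfl

/-- **The direction is a unit vector, so its derivative is orthogonal to it**:
`⟪ξ(x), Dξ(x) h⟫ = 0` (GGH97 §3, "we use the fact that `ξ_j² = 1`"). [cite: GalantiGibbonHeritage1997, §3 (arXiv p. 7)] -/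
theorem inner_vorticityDirection_fderiv_eq_zero (h : DifferentiableAt ℝ ω x) (hx : ω x ≠ 0)
    (v : EuclideanSpace ℝ (Fin 3)) :
    ⟪vorticityDirection ω x, fderiv ℝ (vorticityDirection ω) x v⟫ = 0 := by
  have hr : ‖ω x‖ ≠ 0 := norm_ne_zero_iff.2 hx
  rw [fderiv_vorticityDirection_apply h hx v, vorticityDirection_apply, inner_sub_right,
    real_inner_smul_left, real_inner_smul_right, real_inner_smul_left, real_inner_smul_right,
    real_inner_self_eq_norm_sq]
  field_simp
  ring

/-- **Splitting of the gradient**: `Dω(x) h = (∂_h|ω|) ξ(x) + |ω(x)| Dξ(x) h` for `ω(x) ≠ 0`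
(the product rule for `ω = |ω| ξ`; GGH97 §3 "`ω_j = ωξ_j`"). [cite: GalantiGibbonHeritage1997, §3 (arXiv p. 7)] -/
theorem fderiv_eq_norm_deriv_smul_add (h : DifferentiableAt ℝ ω x) (hx : ω x ≠ 0)
    (v : EuclideanSpace ℝ (Fin 3)) :
    fderiv ℝ ω x v =
      fderiv ℝ (fun y => ‖ω y‖) x v • vorticityDirection ω x +
        ‖ω x‖ • fderiv ℝ (vorticityDirection ω) x v := by
  have hr : ‖ω x‖ ≠ 0 := norm_ne_zero_iff.2 hx
  rw [fderiv_norm_apply' h hx, fderiv_vorticityDirection_apply h hx v, vorticityDirection_apply,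
    real_inner_smul_left, smul_sub, smul_smul, smul_smul, smul_smul]
  have h3 : ‖ω x‖ * ((‖ω x‖ ^ 3)⁻¹ * ⟪ω x, fderiv ℝ ω x v⟫) =
      ‖ω x‖⁻¹ * ⟪ω x, fderiv ℝ ω x v⟫ * ‖ω x‖⁻¹ := by
    field_simp
  rw [h3, mul_inv_cancel₀ hr, one_smul]
  abel

/-- `⟪Dξ(x) h, Dω(x) h⟫ = |ω(x)| ‖Dξ(x) h‖²` for `ω(x) ≠ 0` (pair the splitting of `Dω h` with
`Dξ h ⊥ ξ`; the cross term of GGH97's derivation of (Dw4) from "`ω_j = ωξ_j`").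
[cite: GalantiGibbonHeritage1997, §3 derivation of (Dw4) (arXiv:chao-dyn/9709003 p. 7)] -/
theorem inner_fderiv_vorticityDirection_fderiv (h : DifferentiableAt ℝ ω x) (hx : ω x ≠ 0)
    (v : EuclideanSpace ℝ (Fin 3)) :
    ⟪fderiv ℝ (vorticityDirection ω) x v, fderiv ℝ ω x v⟫ =
      ‖ω x‖ * ‖fderiv ℝ (vorticityDirection ω) x v‖ ^ 2 := by
  conv_lhs => rw [fderiv_eq_norm_deriv_smul_add h hx v]
  rw [inner_add_right, real_inner_smul_right, real_inner_smul_right, real_inner_comm,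
    inner_vorticityDirection_fderiv_eq_zero h hx v, mul_zero, zero_add,
    real_inner_self_eq_norm_sq]

/-- `ω(x) = |ω(x)| ξ(x)` — GGH97's "`ω_j = ωξ_j`" (junk-free: both sides vanish where `ω(x) = 0`).
[cite: GalantiGibbonHeritage1997, §3 (arXiv:chao-dyn/9709003 p. 7, "ω_j = ωξ_j")] -/
theorem norm_smul_vorticityDirection (ω : EuclideanSpace ℝ (Fin 3) → EuclideanSpace ℝ (Fin 3))
    (x : EuclideanSpace ℝ (Fin 3)) : ‖ω x‖ • vorticityDirection ω x = ω x := by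
  by_cases hx : ω x = 0
  · simp [hx]
  · rw [vorticityDirection_apply, smul_smul, mul_inv_cancel₀ (norm_ne_zero_iff.2 hx), one_smul]

end FirstOrder

/-! ### Second-order kinematics: the Laplacians of `|ω|`, `ξ` and `ω` -/

section SecondOrder

variable {ω : EuclideanSpace ℝ (Fin 3) → EuclideanSpace ℝ (Fin 3)} {x : EuclideanSpace ℝ (Fin 3)}

/-- Pointwise expansion of the Laplacian of a map whose gradient is differentiable at `x`:
`ΔG(x) = Σᵢ ∂ᵢ(∂ᵢG)(x)` over any orthonormal basis. [folklore] -/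
private theorem laplacian_eq_sum_vdd {F : Type*} [NormedAddCommGroup F] [NormedSpace ℝ F]
    {G : EuclideanSpace ℝ (Fin 3) → F} {x : EuclideanSpace ℝ (Fin 3)}
    (hG : DifferentiableAt ℝ (fderiv ℝ G) x) {ι : Type*} [Fintype ι]
    (b : OrthonormalBasis ι ℝ (EuclideanSpace ℝ (Fin 3))) :
    (Δ G) x = ∑ i, fderiv ℝ (fun y => fderiv ℝ G y (b i)) x (b i) := by
  rw [congrFun (InnerProductSpace.laplacian_eq_iteratedFDeriv_orthonormalBasis G b) x]
  refine Finset.sum_congr rfl fun i _ => ?_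
  rw [iteratedFDeriv_two_apply, fderiv_clm_apply hG (differentiableAt_const _)]
  simp

/-- A `C²` map has a differentiable gradient at the point. [folklore] -/
private theorem differentiableAt_fderiv_of_contDiffAt_vdd {F : Type*} [NormedAddCommGroup F]
    [NormedSpace ℝ F] {G : EuclideanSpace ℝ (Fin 3) → F} {x : EuclideanSpace ℝ (Fin 3)}
    (hG : ContDiffAt ℝ 2 G x) : DifferentiableAt ℝ (fderiv ℝ G) x :=
  (hG.fderiv_right (m := 1) (by norm_num)).differentiableAt (by simp)

/-- A `C²` map has differentiable partial derivatives at the point. [folklore] -/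
private theorem differentiableAt_fderiv_apply_of_contDiffAt_vdd {F : Type*} [NormedAddCommGroup F]
    [NormedSpace ℝ F] {G : EuclideanSpace ℝ (Fin 3) → F} {x : EuclideanSpace ℝ (Fin 3)}
    (hG : ContDiffAt ℝ 2 G x) (v : EuclideanSpace ℝ (Fin 3)) :
    DifferentiableAt ℝ (fun y => fderiv ℝ G y v) x :=
  (differentiableAt_fderiv_of_contDiffAt_vdd hG).clm_apply (differentiableAt_const v)

/-- A `C²` map is differentiable near the point. [folklore] -/
private theorem eventually_differentiableAt_of_contDiffAt_vdd {F : Type*} [NormedAddCommGroup F]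
    [NormedSpace ℝ F] {G : EuclideanSpace ℝ (Fin 3) → F} {x : EuclideanSpace ℝ (Fin 3)}
    (hG : ContDiffAt ℝ 2 G x) : ∀ᶠ y in 𝓝 x, DifferentiableAt ℝ G y :=
  (hG.eventually (by simp)).mono fun _ hy => hy.differentiableAt (by simp)

/-- The direction field is `C²` where the (`C²`) vorticity does not vanish. [folklore] -/
private theorem contDiffAt_vorticityDirection_vdd {n : WithTop ℕ∞} (hω : ContDiffAt ℝ n ω x)
    (hx : ω x ≠ 0) : ContDiffAt ℝ n (vorticityDirection ω) x := by
  have h1 : ContDiffAt ℝ n (fun y => ‖ω y‖) x := hω.norm ℝ hx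
  have h2 : ContDiffAt ℝ n (fun y => ‖ω y‖⁻¹) x := h1.inv (norm_ne_zero_iff.2 hx)
  show ContDiffAt ℝ n (fun y => ‖ω y‖⁻¹ • ω y) x
  exact h2.smul hω

/-- **GGH97 (Dw4): `Δ|ω| = ⟪ξ, Δω⟫ + |ω| |∇ξ|²_F`** at a point where `ω ≠ 0` and `ω` is `C²`
("From the relations `ω = ω_jξ_j` and `ω_j = ωξ_j` we have `ξ_jΔω_j = −ω|∇ξ|² + Δω`").
Proof: `∂ᵢ|ω| = ⟪ξ, ∂ᵢω⟫` near `x`; differentiate once more and use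
`⟪∂ᵢξ, ∂ᵢω⟫ = |ω| ‖∂ᵢξ‖²`. [cite: GalantiGibbonHeritage1997, §3 display (Dw4) (arXiv:chao-dyn/9709003 p. 7)] -/
theorem laplacian_norm_eq (hω : ContDiffAt ℝ 2 ω x) (hx : ω x ≠ 0) :
    (Δ fun y => ‖ω y‖) x =
      ⟪vorticityDirection ω x, (Δ ω) x⟫ +
        ‖ω x‖ * frobeniusNormSq (fderiv ℝ (vorticityDirection ω) x) := by
  set b := stdOrthonormalBasis ℝ (EuclideanSpace ℝ (Fin 3)) with hb
  have hρ2 : ContDiffAt ℝ 2 (fun y => ‖ω y‖) x := hω.norm ℝ hx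
  have hξ2 : ContDiffAt ℝ 2 (vorticityDirection ω) x := contDiffAt_vorticityDirection_vdd hω hx
  have hωd : DifferentiableAt ℝ ω x := hω.differentiableAt (by simp)
  have hξd : DifferentiableAt ℝ (vorticityDirection ω) x := hξ2.differentiableAt (by simp)
  -- `ω ≠ 0` and `ω` differentiable near `x`
  have hne : ∀ᶠ y in 𝓝 x, ω y ≠ 0 :=
    (hω.continuousAt.eventually_ne hx)
  have hdiff : ∀ᶠ y in 𝓝 x, DifferentiableAt ℝ ω y := eventually_differentiableAt_of_contDiffAt_vdd hω
  rw [laplacian_eq_sum_vdd (differentiableAt_fderiv_of_contDiffAt_vdd hρ2) b,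
    laplacian_eq_sum_vdd (differentiableAt_fderiv_of_contDiffAt_vdd hω) b, inner_sum,
    frobeniusNormSq, ← hb, Finset.mul_sum, ← Finset.sum_add_distrib]
  refine Finset.sum_congr rfl fun i _ => ?_
  -- near `x`, `∂ᵢ|ω| = ⟪ξ, ∂ᵢω⟫`
  have hev : (fun y => fderiv ℝ (fun z => ‖ω z‖) y (b i)) =ᶠ[𝓝 x]
      fun y => ⟪vorticityDirection ω y, fderiv ℝ ω y (b i)⟫ := by
    filter_upwards [hne, hdiff] with y hy hyd
    exact fderiv_norm_apply' hyd hy (b i)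
  rw [hev.fderiv_eq,
    fderiv_inner_apply ℝ hξd (differentiableAt_fderiv_apply_of_contDiffAt_vdd hω (b i)),
    inner_fderiv_vorticityDirection_fderiv hωd hx (b i)]

/-- **GGH97 (Dw5): `Δω = (Δ|ω|) ξ + 2 Σᵢ (∂ᵢ|ω|) ∂ᵢξ + |ω| Δξ`** at a point where `ω ≠ 0` and `ω`
is `C²` ("`Δω_j/ω = Δξ_j + 2∇(ln ω)·∇ξ_j + ξ_jΔω/ω`"): the Leibniz rule for `ω = |ω| ξ`, twice.
[cite: GalantiGibbonHeritage1997, §3 display (Dw5) (arXiv:chao-dyn/9709003 p. 7)] -/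
theorem laplacian_eq_norm_direction (hω : ContDiffAt ℝ 2 ω x) (hx : ω x ≠ 0) :
    (Δ ω) x =
      (Δ fun y => ‖ω y‖) x • vorticityDirection ω x +
        (2 : ℝ) • ∑ i, fderiv ℝ (fun y => ‖ω y‖) x
            (stdOrthonormalBasis ℝ (EuclideanSpace ℝ (Fin 3)) i) •
          fderiv ℝ (vorticityDirection ω) x (stdOrthonormalBasis ℝ (EuclideanSpace ℝ (Fin 3)) i) +
        ‖ω x‖ • (Δ (vorticityDirection ω)) x := by
  set b := stdOrthonormalBasis ℝ (EuclideanSpace ℝ (Fin 3)) with hb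
  set ρ : EuclideanSpace ℝ (Fin 3) → ℝ := fun y => ‖ω y‖ with hρ
  set ξ := vorticityDirection ω with hξ
  have hρ2 : ContDiffAt ℝ 2 ρ x := hω.norm ℝ hx
  have hξ2 : ContDiffAt ℝ 2 ξ x := contDiffAt_vorticityDirection_vdd hω hx
  have hρd : DifferentiableAt ℝ ρ x := hρ2.differentiableAt (by simp)
  have hξd : DifferentiableAt ℝ ξ x := hξ2.differentiableAt (by simp)
  have hne : ∀ᶠ y in 𝓝 x, ω y ≠ 0 := hω.continuousAt.eventually_ne hx
  have hdiff : ∀ᶠ y in 𝓝 x, DifferentiableAt ℝ ω y :=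
    eventually_differentiableAt_of_contDiffAt_vdd hω
  rw [laplacian_eq_sum_vdd (differentiableAt_fderiv_of_contDiffAt_vdd hω) b,
    laplacian_eq_sum_vdd (differentiableAt_fderiv_of_contDiffAt_vdd hρ2) b,
    laplacian_eq_sum_vdd (differentiableAt_fderiv_of_contDiffAt_vdd hξ2) b,
    Finset.sum_smul, Finset.smul_sum, Finset.smul_sum, ← Finset.sum_add_distrib,
    ← Finset.sum_add_distrib]
  refine Finset.sum_congr rfl fun i _ => ?_
  -- near `x`, `∂ᵢω = (∂ᵢρ) ξ + ρ ∂ᵢξ`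
  have hev : (fun y => fderiv ℝ ω y (b i)) =ᶠ[𝓝 x]
      fun y => fderiv ℝ ρ y (b i) • ξ y + ρ y • fderiv ℝ ξ y (b i) := by
    filter_upwards [hne, hdiff] with y hy hyd
    exact fderiv_eq_norm_deriv_smul_add hyd hy (b i)
  have hA : DifferentiableAt ℝ (fun y => fderiv ℝ ρ y (b i)) x :=
    differentiableAt_fderiv_apply_of_contDiffAt_vdd hρ2 (b i)
  have hB : DifferentiableAt ℝ (fun y => fderiv ℝ ξ y (b i)) x :=
    differentiableAt_fderiv_apply_of_contDiffAt_vdd hξ2 (b i)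
  have hS1 : DifferentiableAt ℝ (fun y => fderiv ℝ ρ y (b i) • ξ y) x := hA.smul hξd
  have hS2 : DifferentiableAt ℝ (fun y => ρ y • fderiv ℝ ξ y (b i)) x := hρd.smul hB
  rw [hev.fderiv_eq, fderiv_fun_add hS1 hS2, _root_.add_apply,
    fderiv_fun_smul hA hξd, fderiv_fun_smul hρd hB, _root_.add_apply,
    _root_.add_apply, _root_.smul_apply, _root_.smul_apply,
    ContinuousLinearMap.smulRight_apply, ContinuousLinearMap.smulRight_apply, two_smul]
  abel

/-- **`⟪ξ, Δξ⟫ = −|∇ξ|²_F`** where `ω ≠ 0` and `ω` is `C²` (GGH97 §3: "`ξ_j² = 1` leading to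
`ξ_jΔξ_j + |∇ξ_j|² = 0`"). From (Dw4)–(Dw5) paired with `ξ`.
[cite: GalantiGibbonHeritage1997, §3 (arXiv:chao-dyn/9709003 p. 7)] -/
theorem inner_vorticityDirection_laplacian (hω : ContDiffAt ℝ 2 ω x) (hx : ω x ≠ 0) :
    ⟪vorticityDirection ω x, (Δ (vorticityDirection ω)) x⟫ =
      -frobeniusNormSq (fderiv ℝ (vorticityDirection ω) x) := by
  have hr : ‖ω x‖ ≠ 0 := norm_ne_zero_iff.2 hx
  have hωd : DifferentiableAt ℝ ω x := hω.differentiableAt (by simp)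
  have h1 := laplacian_norm_eq hω hx
  have h2 := congrArg (fun w => ⟪vorticityDirection ω x, w⟫) (laplacian_eq_norm_direction hω hx)
  simp only [inner_add_right, real_inner_smul_right, inner_sum,
    inner_vorticityDirection_fderiv_eq_zero hωd hx, mul_zero, Finset.sum_const_zero] at h2
  rw [real_inner_self_eq_norm_sq, norm_vorticityDirection ω hx, one_pow, mul_one] at h2
  -- `h1 : Δρ = ⟪ξ,Δω⟫ + ρ F`, `h2 : ⟪ξ,Δω⟫ = Δρ + 0 + ρ ⟪ξ,Δξ⟫`
  have h3 : ‖ω x‖ * ⟪vorticityDirection ω x, (Δ (vorticityDirection ω)) x⟫ =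
      ‖ω x‖ * (-frobeniusNormSq (fderiv ℝ (vorticityDirection ω) x)) := by linarith
  exact mul_left_cancel₀ hr h3

end SecondOrder

/-! ### Time derivatives of `|ω|` and `ξ` along a curve of fields -/

section Time

variable {ω : ℝ → EuclideanSpace ℝ (Fin 3) → EuclideanSpace ℝ (Fin 3)}
  {x : EuclideanSpace ℝ (Fin 3)} {t : ℝ} {w : EuclideanSpace ℝ (Fin 3)}

/-- **`∂ₜ|ω| = ⟪ξ, ∂ₜω⟫`** at a point where `ω(t,x) ≠ 0` (chain rule for the norm along
`s ↦ ω(s,x)`; GGH97 §3 "`ω = ω_jξ_j`"). [cite: GalantiGibbonHeritage1997, §3 (arXiv p. 7)] -/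
theorem hasDerivAt_norm_of_hasDerivAt (h : HasDerivAt (fun s => ω s x) w t) (hx : ω t x ≠ 0) :
    HasDerivAt (fun s => ‖ω s x‖) ⟪vorticityDirection (ω t) x, w⟫ t := by
  have hpos : 0 < ‖ω t x‖ := norm_pos_iff.2 hx
  have h1 : HasDerivAt (fun s => ‖ω s x‖ ^ 2) (2 * ⟪ω t x, w⟫) t := h.norm_sq
  have h2 := h1.sqrt (by positivity : ‖ω t x‖ ^ 2 ≠ 0)
  have h3 : HasDerivAt (fun s => ‖ω s x‖) (2 * ⟪ω t x, w⟫ / (2 * Real.sqrt (‖ω t x‖ ^ 2))) t :=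
    h2.congr_of_eventuallyEq (Eventually.of_forall fun s => (Real.sqrt_sq (norm_nonneg _)).symm)
  convert h3 using 1
  rw [Real.sqrt_sq hpos.le, vorticityDirection_apply, real_inner_smul_left]
  field_simp

/-- **`∂ₜξ = |ω|⁻¹ (∂ₜω − ⟪ξ, ∂ₜω⟫ ξ)`** at a point where `ω(t,x) ≠ 0` (quotient rule for
`ξ = ω/|ω|` along `s ↦ ω(s,x)`; GGH97 §3 display (Dξ/Dt) before the substitution of the
equation). [cite: GalantiGibbonHeritage1997, §3 display (Dxi/Dt) (arXiv p. 7)] -/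
theorem hasDerivAt_vorticityDirection_of_hasDerivAt (h : HasDerivAt (fun s => ω s x) w t)
    (hx : ω t x ≠ 0) :
    HasDerivAt (fun s => vorticityDirection (ω s) x)
      (‖ω t x‖⁻¹ • (w - ⟪vorticityDirection (ω t) x, w⟫ • vorticityDirection (ω t) x)) t := by
  have hr : ‖ω t x‖ ≠ 0 := norm_ne_zero_iff.2 hx
  have h1 := hasDerivAt_norm_of_hasDerivAt h hx
  have h2 : HasDerivAt (fun s => ‖ω s x‖⁻¹)
      (-⟪vorticityDirection (ω t) x, w⟫ / ‖ω t x‖ ^ 2) t := h1.inv hr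
  have h3 : HasDerivAt (fun s => ‖ω s x‖⁻¹ • ω s x)
      (‖ω t x‖⁻¹ • w + (-⟪vorticityDirection (ω t) x, w⟫ / ‖ω t x‖ ^ 2) • ω t x) t :=
    h2.smul h
  have h4 : (fun s => vorticityDirection (ω s) x) = fun s => ‖ω s x‖⁻¹ • ω s x := by
    funext s
    exact vorticityDirection_apply _ _
  rw [h4]
  convert h3 using 1
  rw [vorticityDirection_apply, smul_sub, smul_smul, smul_smul, sub_eq_add_neg, ← neg_smul]
  congr 1
  congr 1
  field_simp

end Time

/-! ### Dynamics: magnitude and direction under a transport–diffusion–stretching equation -/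

section Dynamics

variable {ω : ℝ → EuclideanSpace ℝ (Fin 3) → EuclideanSpace ℝ (Fin 3)}
  {x : EuclideanSpace ℝ (Fin 3)} {t ν : ℝ} {v σ : EuclideanSpace ℝ (Fin 3)}

/-- The inner product of the direction with the right-hand side of the equation:
`⟪ξ, νΔω − ∂_vω + σ⟫ = ν(Δ|ω| − |ω||∇ξ|²_F) − ∂_v|ω| + ⟪ξ, σ⟫`. [folklore] -/
private theorem inner_direction_rhs (hω : ContDiffAt ℝ 2 (ω t) x) (hx : ω t x ≠ 0) :
    ⟪vorticityDirection (ω t) x, ν • (Δ (ω t)) x - fderiv ℝ (ω t) x v + σ⟫ =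
      ν * ((Δ fun y => ‖ω t y‖) x -
            ‖ω t x‖ * frobeniusNormSq (fderiv ℝ (vorticityDirection (ω t)) x)) -
        fderiv ℝ (fun y => ‖ω t y‖) x v + ⟪vorticityDirection (ω t) x, σ⟫ := by
  rw [inner_add_right, inner_sub_right, real_inner_smul_right, laplacian_norm_eq hω hx,
    fderiv_norm_apply' (hω.differentiableAt (by simp)) hx v]
  ring

/-- **The magnitude equation.** If `s ↦ ω(s,x)` satisfies at `s = t` the pointwise
transport–diffusion–stretching equation `∂ₜω = νΔω − ∂_vω + σ` (`v`: advecting velocity at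
`(t,x)`, `σ`: stretching vector), `ω(t,·)` is `C²` near `x` and `ω(t,x) ≠ 0`, then `ρ = |ω|`
satisfies `∂ₜρ = νΔρ − ∂_vρ + (⟪ξ, σ⟫ − νρ|∇ξ|²_F)` at `(t,x)` — GGH97 (Dw1) combined with (Dw4):
"`Dω/Dt = αω + νξ_jΔω_j`", "`ξ_jΔω_j = −ω|∇ξ|² + Δω`".
[cite: GalantiGibbonHeritage1997, §3 displays (Dw1), (Dw4) (arXiv:chao-dyn/9709003 p. 7)] -/
theorem hasDerivAt_norm_of_vorticityEquation (hω : ContDiffAt ℝ 2 (ω t) x) (hx : ω t x ≠ 0)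
    (heq : HasDerivAt (fun s => ω s x) (ν • (Δ (ω t)) x - fderiv ℝ (ω t) x v + σ) t) :
    HasDerivAt (fun s => ‖ω s x‖)
      (ν * (Δ fun y => ‖ω t y‖) x - fderiv ℝ (fun y => ‖ω t y‖) x v +
        (⟪vorticityDirection (ω t) x, σ⟫ -
          ν * (‖ω t x‖ * frobeniusNormSq (fderiv ℝ (vorticityDirection (ω t)) x)))) t := by
  have h1 := hasDerivAt_norm_of_hasDerivAt heq hx
  rw [inner_direction_rhs hω hx] at h1
  convert h1 using 1
  ring

/-- **The direction equation.** Under the same hypotheses, `ξ = ω/|ω|` satisfies at `(t,x)`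
`∂ₜξ = νΔξ − ∂_vξ + (|ω|⁻¹(σ − ⟪ξ,σ⟫ξ) + 2ν|ω|⁻¹ Σᵢ (∂ᵢ|ω|) ∂ᵢξ + ν|∇ξ|²_F ξ)` — GGH97
(Dxi/Dt,2): "`Dξ_j/Dt = S_jkξ_k − αξ_j + νΔξ_j + ν|∇ξ|²ξ_j + νβ_j`, `β_j = ∂_k(ln|ω|²)∂_kξ_j`"
(the sum runs over the standard orthonormal basis of `ℝ³`; `|ω|⁻¹(σ − ⟪ξ,σ⟫ξ)` is the tilting
vector `Sξ − αξ` when `σ = Sω`).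
[cite: GalantiGibbonHeritage1997, §3 displays (Dxi/Dt), (Dw5), (Dxi/Dt,2), (djdef) (arXiv:chao-dyn/9709003 p. 7)] -/
theorem hasDerivAt_vorticityDirection_of_vorticityEquation (hω : ContDiffAt ℝ 2 (ω t) x)
    (hx : ω t x ≠ 0)
    (heq : HasDerivAt (fun s => ω s x) (ν • (Δ (ω t)) x - fderiv ℝ (ω t) x v + σ) t) :
    HasDerivAt (fun s => vorticityDirection (ω s) x)
      (ν • (Δ (vorticityDirection (ω t))) x - fderiv ℝ (vorticityDirection (ω t)) x v +
        (‖ω t x‖⁻¹ • (σ - ⟪vorticityDirection (ω t) x, σ⟫ • vorticityDirection (ω t) x) +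
          (2 * ν * ‖ω t x‖⁻¹) •
            ∑ i, fderiv ℝ (fun y => ‖ω t y‖) x (stdOrthonormalBasis ℝ (EuclideanSpace ℝ (Fin 3)) i) •
              fderiv ℝ (vorticityDirection (ω t)) x
                (stdOrthonormalBasis ℝ (EuclideanSpace ℝ (Fin 3)) i) +
          (ν * frobeniusNormSq (fderiv ℝ (vorticityDirection (ω t)) x)) •
            vorticityDirection (ω t) x)) t := by
  have hr : ‖ω t x‖ ≠ 0 := norm_ne_zero_iff.2 hx
  have hd : DifferentiableAt ℝ (ω t) x := hω.differentiableAt (by simp)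
  have h1 := hasDerivAt_vorticityDirection_of_hasDerivAt heq hx
  rw [inner_direction_rhs hω hx] at h1
  convert h1 using 1
  rw [laplacian_eq_norm_direction hω hx, fderiv_eq_norm_deriv_smul_add hd hx v]
  -- a linear identity in the vectors `Δξ`, `∂_vξ`, `σ`, `ξ`, `Σᵢ (∂ᵢρ) ∂ᵢξ`
  set ρ := ‖ω t x‖
  set ξ := vorticityDirection (ω t) x
  set F := frobeniusNormSq (fderiv ℝ (vorticityDirection (ω t)) x)
  set Lρ := (Δ fun y => ‖ω t y‖) x
  set dρ := fderiv ℝ (fun y => ‖ω t y‖) x v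
  set Lξ := (Δ (vorticityDirection (ω t))) x
  set dξ := fderiv ℝ (vorticityDirection (ω t)) x v
  set S := ∑ i, fderiv ℝ (fun y => ‖ω t y‖) x (stdOrthonormalBasis ℝ (EuclideanSpace ℝ (Fin 3)) i) •
    fderiv ℝ (vorticityDirection (ω t)) x (stdOrthonormalBasis ℝ (EuclideanSpace ℝ (Fin 3)) i)
  match_scalars <;> field_simp
  ring

/-- Local form of `Δ|W|² = 2⟪ΔW, W⟫ + 2|∇W|²_F` for a field `C²` near the point. [folklore] -/
private theorem laplacian_norm_sq_eq_vdd {W : EuclideanSpace ℝ (Fin 3) → EuclideanSpace ℝ (Fin 3)}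
    {x : EuclideanSpace ℝ (Fin 3)} (hW : ContDiffAt ℝ 2 W x) :
    (Δ fun y => ‖W y‖ ^ 2) x = 2 * ⟪W x, (Δ W) x⟫ + 2 * frobeniusNormSq (fderiv ℝ W x) := by
  set b := stdOrthonormalBasis ℝ (EuclideanSpace ℝ (Fin 3)) with hb
  have hsq : ContDiffAt ℝ 2 (fun y => ‖W y‖ ^ 2) x := hW.norm_sq ℝ
  have hWd : DifferentiableAt ℝ W x := hW.differentiableAt (by simp)
  have hdiff : ∀ᶠ y in 𝓝 x, DifferentiableAt ℝ W y := eventually_differentiableAt_of_contDiffAt_vdd hW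
  rw [laplacian_eq_sum_vdd (differentiableAt_fderiv_of_contDiffAt_vdd hsq) b,
    laplacian_eq_sum_vdd (differentiableAt_fderiv_of_contDiffAt_vdd hW) b, inner_sum,
    frobeniusNormSq, ← hb, Finset.mul_sum, Finset.mul_sum, ← Finset.sum_add_distrib]
  refine Finset.sum_congr rfl fun i _ => ?_
  have hev : (fun y => fderiv ℝ (fun z => ‖W z‖ ^ 2) y (b i)) =ᶠ[𝓝 x]
      fun y => 2 * ⟪W y, fderiv ℝ W y (b i)⟫ := by
    filter_upwards [hdiff] with y hyd
    rw [show (fun z => ‖W z‖ ^ 2) = fun z => ⟪W z, W z⟫ from funext fun z =>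
        (real_inner_self_eq_norm_sq (W z)).symm,
      fderiv_inner_apply ℝ hyd hyd, real_inner_comm]
    ring
  have hA : DifferentiableAt ℝ (fun y => fderiv ℝ W y (b i)) x :=
    differentiableAt_fderiv_apply_of_contDiffAt_vdd hW (b i)
  rw [hev.fderiv_eq, fderiv_const_mul (hWd.inner ℝ hA), _root_.smul_apply, smul_eq_mul,
    fderiv_inner_apply ℝ hWd hA, real_inner_self_eq_norm_sq]
  ring

/-- **The squared-magnitude equation** (Constantin–Fefferman 1993, (10), with the factors `2`
restored): if `s ↦ ω(s,x)` satisfies `∂ₜω = νΔω − ∂_vω + σ` at `s = t` and `ω(t,·)` is `C²` near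
`x`, then `∂ₜ|ω|² = νΔ|ω|² − ∂_v|ω|² + (2⟪ω, σ⟫ − 2ν|∇ω|²_F)` at `(t,x)`, i.e.
`(∂ₜ + u·∇ − νΔ)|ω|² + 2ν|∇ω|² = 2⟪ω,σ⟫` (`= 2α|ω|²` for `σ = Sω`).  No non-vanishing of `ω` is
needed. [cite: ConstantinFefferman1993, p. 779 (10)] -/
theorem hasDerivAt_norm_sq_of_vorticityEquation (hω : ContDiffAt ℝ 2 (ω t) x)
    (heq : HasDerivAt (fun s => ω s x) (ν • (Δ (ω t)) x - fderiv ℝ (ω t) x v + σ) t) :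
    HasDerivAt (fun s => ‖ω s x‖ ^ 2)
      (ν * (Δ fun y => ‖ω t y‖ ^ 2) x - fderiv ℝ (fun y => ‖ω t y‖ ^ 2) x v +
        (2 * ⟪ω t x, σ⟫ - 2 * ν * frobeniusNormSq (fderiv ℝ (ω t) x))) t := by
  have hd : DifferentiableAt ℝ (ω t) x := hω.differentiableAt (by simp)
  have h1 : HasDerivAt (fun s => ‖ω s x‖ ^ 2) (2 * ⟪ω t x, ν • (Δ (ω t)) x - fderiv ℝ (ω t) x v + σ⟫) t :=
    heq.norm_sq
  convert h1 using 1
  have h2 : fderiv ℝ (fun y => ‖ω t y‖ ^ 2) x v = 2 * ⟪ω t x, fderiv ℝ (ω t) x v⟫ := by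
    rw [show (fun y => ‖ω t y‖ ^ 2) = fun y => ⟪ω t y, ω t y⟫ from funext fun y =>
        (real_inner_self_eq_norm_sq (ω t y)).symm,
      fderiv_inner_apply ℝ hd hd, real_inner_comm]
    ring
  rw [laplacian_norm_sq_eq_vdd hω, h2, inner_add_right, inner_sub_right, real_inner_smul_right]
  ring

end Dynamics

end VorticityDirectionDynamics

/-! ### The Navier–Stokes vorticity equation: `σ = (ω·∇)u = ∇u ω`, `α = ⟪ξ, ∇u ξ⟫` -/

namespace VorticityDirectionDynamics.NavierStokes

open VorticityDirectionDynamics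

variable {u : ℝ → EuclideanSpace ℝ (Fin 3) → EuclideanSpace ℝ (Fin 3)}
  {x : EuclideanSpace ℝ (Fin 3)} {t ν : ℝ}

/-- For `ω = curl u` the stretching vector is `∇u ω = |ω| ∇u ξ` (linearity in "`ω_j = ωξ_j`";
Constantin–Fefferman's display before (10): "`(S(x,t)ω(x,t))·ω(x,t) = α(x,t)|ω(x,t)|²`").
[cite: ConstantinFefferman1993, p. 779, display before (10)] -/
theorem stretching_eq_norm_smul (u : ℝ → EuclideanSpace ℝ (Fin 3) → EuclideanSpace ℝ (Fin 3))
    (t : ℝ) (x : EuclideanSpace ℝ (Fin 3)) :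
    fderiv ℝ (u t) x (curl (u t) x) =
      ‖curl (u t) x‖ • fderiv ℝ (u t) x (vorticityDirection (curl (u t)) x) := by
  conv_lhs => rw [← norm_smul_vorticityDirection (curl (u t)) x]
  rw [map_smul]

/-- `⟪ξ, ∇u ω⟫ = α |ω|` with the stretching rate `α = ⟪ξ, ∇u ξ⟫` — Constantin–Fefferman p. 779:
"`(S(x,t)ω(x,t))·ω(x,t) = α(x,t)|ω(x,t)|²` … represents the stretching term in the evolution of the
vorticity magnitude", divided by `|ω|`. [cite: ConstantinFefferman1993, p. 779, display before (10)] -/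
theorem inner_direction_stretching (u : ℝ → EuclideanSpace ℝ (Fin 3) → EuclideanSpace ℝ (Fin 3))
    (t : ℝ) (x : EuclideanSpace ℝ (Fin 3)) :
    ⟪vorticityDirection (curl (u t)) x, fderiv ℝ (u t) x (curl (u t) x)⟫ =
      ⟪vorticityDirection (curl (u t)) x,
          fderiv ℝ (u t) x (vorticityDirection (curl (u t)) x)⟫ * ‖curl (u t) x‖ := by
  rw [stretching_eq_norm_smul, real_inner_smul_right, mul_comm]

/-- **Navier–Stokes, magnitude of vorticity** (GGH97 (Dw1) + (Dw4)): if the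
classical vorticity equation holds at `(t,x)` in the form
`∂ₜω = νΔω − (u·∇)ω + (ω·∇)u` (`ω = curl u`; the shape delivered by
`IsLerayHopfOn.vorticity_classical_of_contDiffOn`), `ω(t,·)` is `C²` near `x` and `ω(t,x) ≠ 0`, then
`∂ₜ|ω| = νΔ|ω| − (u·∇)|ω| + (α|ω| − ν|ω||∇ξ|²_F)` at `(t,x)`, `α = ⟪ξ, ∇u ξ⟫`, `ξ = ω/|ω|` —
i.e. `(∂ₜ + u·∇ − νΔ)|ω| + ν|ω||∇ξ|² = α|ω|`.
[cite: GalantiGibbonHeritage1997, §3 displays (Dw1), (Dw4) (arXiv:chao-dyn/9709003 p. 7)] -/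
theorem hasDerivAt_norm_curl (hω : ContDiffAt ℝ 2 (curl (u t)) x) (hx : curl (u t) x ≠ 0)
    (heq : HasDerivAt (fun s => curl (u s) x)
      (ν • (Δ (curl (u t))) x - convect (u t) (curl (u t)) x + convect (curl (u t)) (u t) x) t) :
    HasDerivAt (fun s => ‖curl (u s) x‖)
      (ν * (Δ fun y => ‖curl (u t) y‖) x - fderiv ℝ (fun y => ‖curl (u t) y‖) x (u t x) +
        (⟪vorticityDirection (curl (u t)) x,
              fderiv ℝ (u t) x (vorticityDirection (curl (u t)) x)⟫ * ‖curl (u t) x‖ -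
          ν * (‖curl (u t) x‖ *
            frobeniusNormSq (fderiv ℝ (vorticityDirection (curl (u t))) x)))) t := by
  rw [convect_apply, convect_apply] at heq
  have h := hasDerivAt_norm_of_vorticityEquation (ω := fun s => curl (u s)) hω hx heq
  rwa [inner_direction_stretching] at h

/-- **Navier–Stokes, direction of vorticity** (GGH97 (Dxi/Dt,2)): under the same hypotheses,
`∂ₜξ = νΔξ − (u·∇)ξ + ((∇u ξ − αξ) + 2ν|ω|⁻¹Σᵢ(∂ᵢ|ω|)∂ᵢξ + ν|∇ξ|²_F ξ)` at `(t,x)`: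
"`Dξ_j/Dt = S_jkξ_k − αξ_j + νΔξ_j + ν|∇ξ|²ξ_j + νβ_j`, `β_j = ∂_k(ln|ω|²)∂_kξ_j`", with the
tilting vector `∇u ξ − αξ = Sξ − αξ` written through `∇u` (the antisymmetric part of `∇u` kills
`ξ ∥ ω`). [cite: GalantiGibbonHeritage1997, §3 display (Dxi/Dt,2) with (djdef) (arXiv:chao-dyn/9709003 p. 7)] -/
theorem hasDerivAt_vorticityDirection (hω : ContDiffAt ℝ 2 (curl (u t)) x)
    (hx : curl (u t) x ≠ 0)
    (heq : HasDerivAt (fun s => curl (u s) x)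
      (ν • (Δ (curl (u t))) x - convect (u t) (curl (u t)) x + convect (curl (u t)) (u t) x) t) :
    HasDerivAt (fun s => vorticityDirection (curl (u s)) x)
      (ν • (Δ (vorticityDirection (curl (u t)))) x -
          fderiv ℝ (vorticityDirection (curl (u t))) x (u t x) +
        ((fderiv ℝ (u t) x (vorticityDirection (curl (u t)) x) -
            ⟪vorticityDirection (curl (u t)) x,
                fderiv ℝ (u t) x (vorticityDirection (curl (u t)) x)⟫ •
              vorticityDirection (curl (u t)) x) +
          (2 * ν * ‖curl (u t) x‖⁻¹) •
            ∑ i, fderiv ℝ (fun y => ‖curl (u t) y‖) x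
                (stdOrthonormalBasis ℝ (EuclideanSpace ℝ (Fin 3)) i) •
              fderiv ℝ (vorticityDirection (curl (u t))) x
                (stdOrthonormalBasis ℝ (EuclideanSpace ℝ (Fin 3)) i) +
          (ν * frobeniusNormSq (fderiv ℝ (vorticityDirection (curl (u t))) x)) •
            vorticityDirection (curl (u t)) x)) t := by
  rw [convect_apply, convect_apply] at heq
  have hr : ‖curl (u t) x‖ ≠ 0 := norm_ne_zero_iff.2 hx
  have h := hasDerivAt_vorticityDirection_of_vorticityEquation (ω := fun s => curl (u s)) hω hx heq
  convert h using 3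
  rw [inner_direction_stretching, stretching_eq_norm_smul, smul_sub, smul_smul, smul_smul,
    inv_mul_cancel₀ hr, one_smul, mul_comm _ ‖curl (u t) x‖, ← mul_assoc, inv_mul_cancel₀ hr,
    one_mul]

/-- **Navier–Stokes, squared magnitude** (Constantin–Fefferman 1993, p. 779, (10), factors `2`
restored): `∂ₜ|ω|² = νΔ|ω|² − (u·∇)|ω|² + (2⟪ω, ∇u ω⟫ − 2ν|∇ω|²_F)` at `(t,x)`, i.e.
`(∂ₜ + u·∇ − νΔ)|ω|² + 2ν|∇ω|² = 2α|ω|²` (`⟪ω, ∇u ω⟫ = ⟪ω, Sω⟫ = α|ω|²`); no non-vanishing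
needed. [cite: ConstantinFefferman1993, p. 779 (10)] -/
theorem hasDerivAt_norm_curl_sq (hω : ContDiffAt ℝ 2 (curl (u t)) x)
    (heq : HasDerivAt (fun s => curl (u s) x)
      (ν • (Δ (curl (u t))) x - convect (u t) (curl (u t)) x + convect (curl (u t)) (u t) x) t) :
    HasDerivAt (fun s => ‖curl (u s) x‖ ^ 2)
      (ν * (Δ fun y => ‖curl (u t) y‖ ^ 2) x - fderiv ℝ (fun y => ‖curl (u t) y‖ ^ 2) x (u t x) +
        (2 * ⟪curl (u t) x, fderiv ℝ (u t) x (curl (u t) x)⟫ -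
          2 * ν * frobeniusNormSq (fderiv ℝ (curl (u t)) x))) t := by
  rw [convect_apply, convect_apply] at heq
  exact hasDerivAt_norm_sq_of_vorticityEquation (ω := fun s => curl (u s)) hω heq

/-- **Tilting-free points: the direction solves a source-free drift–harmonic-map heat flow.**
If in addition the tilting vector vanishes at `(t,x)`, `∇u ξ = αξ` (vorticity is an eigenvector of
`∇u`, equivalently of the strain `S`; `ω × Sω = 0`, see `cross_eq_zero_iff_apply_eq_smul`), then
`∂ₜξ = νΔξ − (u·∇)ξ + 2ν|ω|⁻¹Σᵢ(∂ᵢ|ω|)∂ᵢξ + ν|∇ξ|²_F ξ` at `(t,x)` (GGH97 (Dxi/Dt,2) with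
`S_jkξ_k − αξ_j = 0`). [cite: GalantiGibbonHeritage1997, §3 display (Dxi/Dt,2) (arXiv:chao-dyn/9709003 p. 7)] -/
theorem hasDerivAt_vorticityDirection_of_tiltingFree (hω : ContDiffAt ℝ 2 (curl (u t)) x)
    (hx : curl (u t) x ≠ 0)
    (heq : HasDerivAt (fun s => curl (u s) x)
      (ν • (Δ (curl (u t))) x - convect (u t) (curl (u t)) x + convect (curl (u t)) (u t) x) t)
    (htilt : fderiv ℝ (u t) x (vorticityDirection (curl (u t)) x) =
      ⟪vorticityDirection (curl (u t)) x,
          fderiv ℝ (u t) x (vorticityDirection (curl (u t)) x)⟫ •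
        vorticityDirection (curl (u t)) x) :
    HasDerivAt (fun s => vorticityDirection (curl (u s)) x)
      (ν • (Δ (vorticityDirection (curl (u t)))) x -
          fderiv ℝ (vorticityDirection (curl (u t))) x (u t x) +
        ((2 * ν * ‖curl (u t) x‖⁻¹) •
            ∑ i, fderiv ℝ (fun y => ‖curl (u t) y‖) x
                (stdOrthonormalBasis ℝ (EuclideanSpace ℝ (Fin 3)) i) •
              fderiv ℝ (vorticityDirection (curl (u t))) x
                (stdOrthonormalBasis ℝ (EuclideanSpace ℝ (Fin 3)) i) +
          (ν * frobeniusNormSq (fderiv ℝ (vorticityDirection (curl (u t))) x)) •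
            vorticityDirection (curl (u t)) x)) t := by
  have h := hasDerivAt_vorticityDirection hω hx heq
  rw [← htilt, sub_self, zero_add] at h
  exact h

/-- **Stretching-free points: the magnitude is a drift–heat subsolution with the direction
dissipation as absorption.** If the stretching rate vanishes at `(t,x)`, `⟪ω, ∇u ω⟫ = 0`
(`= ⟪ω, Sω⟫ = α|ω|²`), then `∂ₜ|ω| = νΔ|ω| − (u·∇)|ω| − ν|ω||∇ξ|²_F` there (GGH97 (Dw1)+(Dw4)
with `α = 0`). [cite: GalantiGibbonHeritage1997, §3 displays (Dw1), (Dw4) (arXiv:chao-dyn/9709003 p. 7)] -/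
theorem hasDerivAt_norm_curl_of_stretchingFree (hω : ContDiffAt ℝ 2 (curl (u t)) x)
    (hx : curl (u t) x ≠ 0)
    (heq : HasDerivAt (fun s => curl (u s) x)
      (ν • (Δ (curl (u t))) x - convect (u t) (curl (u t)) x + convect (curl (u t)) (u t) x) t)
    (hα : ⟪curl (u t) x, fderiv ℝ (u t) x (curl (u t) x)⟫ = 0) :
    HasDerivAt (fun s => ‖curl (u s) x‖)
      (ν * (Δ fun y => ‖curl (u t) y‖) x - fderiv ℝ (fun y => ‖curl (u t) y‖) x (u t x) -
        ν * (‖curl (u t) x‖ *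
          frobeniusNormSq (fderiv ℝ (vorticityDirection (curl (u t))) x))) t := by
  have hr : ‖curl (u t) x‖ ≠ 0 := norm_ne_zero_iff.2 hx
  have h := hasDerivAt_norm_curl hω hx heq
  have h0 : ⟪vorticityDirection (curl (u t)) x,
      fderiv ℝ (u t) x (vorticityDirection (curl (u t)) x)⟫ * ‖curl (u t) x‖ = 0 := by
    rw [← inner_direction_stretching, vorticityDirection_apply, real_inner_smul_left, hα, mul_zero]
  rw [h0, zero_sub] at h
  convert h using 1
  ring

end VorticityDirectionDynamics.NavierStokes

/-! ### The two spellings of "tilting-free": `ω × Aω = 0` iff `Aξ = ⟪ξ, Aξ⟫ ξ` -/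

namespace VorticityDirectionDynamics

/-- The real inner product of `EuclideanSpace ℝ (Fin 3)` as a dot product. [folklore] -/
private theorem real_inner_eq_dotProduct_vdd (a b : EuclideanSpace ℝ (Fin 3)) :
    ⟪a, b⟫ = WithLp.ofLp a ⬝ᵥ WithLp.ofLp b := by
  rw [EuclideanSpace.inner_eq_star_dotProduct, star_trivial, dotProduct_comm]

/-- `a × b = 0` with `a ≠ 0` forces `b = (⟪a,b⟫/‖a‖²) a`; conversely multiples of `a` have zero
cross product with `a`. [folklore] -/
private theorem cross_eq_zero_iff_eq_smul {a b : EuclideanSpace ℝ (Fin 3)} (ha : a ≠ 0) :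
    cross a b = 0 ↔ b = (⟪a, b⟫ / ‖a‖ ^ 2) • a := by
  have haa : WithLp.ofLp a ⬝ᵥ WithLp.ofLp a = ‖a‖ ^ 2 := by
    rw [← real_inner_eq_dotProduct_vdd, real_inner_self_eq_norm_sq]
  have hne : ‖a‖ ^ 2 ≠ 0 := pow_ne_zero 2 (norm_ne_zero_iff.2 ha)
  constructor
  · intro h
    have h0 : WithLp.ofLp a ⨯₃ WithLp.ofLp b = 0 := by
      have := congrArg WithLp.ofLp h
      simpa [cross] using this
    have key := cross_cross_eq_smul_sub_smul' (WithLp.ofLp a) (WithLp.ofLp a) (WithLp.ofLp b)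
    rw [h0, map_zero, haa, ← real_inner_eq_dotProduct_vdd] at key
    -- `key : 0 = ⟪a,b⟫ • a − ‖a‖² • b` in coordinates
    have key' : ‖a‖ ^ 2 • b = ⟪a, b⟫ • a := by
      apply WithLp.ofLp_injective (p := 2)
      rw [WithLp.ofLp_smul, WithLp.ofLp_smul]
      exact (sub_eq_zero.1 key.symm).symm
    calc b = (‖a‖ ^ 2)⁻¹ • (‖a‖ ^ 2 • b) := by rw [smul_smul, inv_mul_cancel₀ hne, one_smul]
      _ = (⟪a, b⟫ / ‖a‖ ^ 2) • a := by rw [key', smul_smul, div_eq_inv_mul]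
  · intro h
    rw [h]
    apply WithLp.ofLp_injective (p := 2)
    show WithLp.ofLp a ⨯₃ WithLp.ofLp ((⟪a, b⟫ / ‖a‖ ^ 2) • a) = WithLp.ofLp (0 : EuclideanSpace ℝ (Fin 3))
    rw [WithLp.ofLp_smul, LinearMap.map_smul, cross_self, smul_zero, WithLp.ofLp_zero]

/-- **Tilting-free, two spellings.** For `ω ≠ 0` and a linear map `A` (think `A = ∇u(x)`, so that
`Aω = Sω` is the vortex-stretching vector), `ω × Aω = 0` iff `Aξ = ⟪ξ, Aξ⟫ ξ`, `ξ = ω/|ω|`: the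
vorticity is an eigenvector of `A` with eigenvalue the stretching rate `α = ⟪ξ, Aξ⟫` (GGH97 §1:
"when `φ = 0` the vectors `ω` and `Sω` are parallel and only stretching occurs").
[cite: GalantiGibbonHeritage1997, §1 (arXiv:chao-dyn/9709003 p. 3)] -/
theorem cross_eq_zero_iff_apply_eq_smul {ω : EuclideanSpace ℝ (Fin 3) → EuclideanSpace ℝ (Fin 3)}
    {x : EuclideanSpace ℝ (Fin 3)} (hx : ω x ≠ 0)
    (A : EuclideanSpace ℝ (Fin 3) →L[ℝ] EuclideanSpace ℝ (Fin 3)) :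
    cross (ω x) (A (ω x)) = 0 ↔
      A (vorticityDirection ω x) =
        ⟪vorticityDirection ω x, A (vorticityDirection ω x)⟫ • vorticityDirection ω x := by
  have hr : ‖ω x‖ ≠ 0 := norm_ne_zero_iff.2 hx
  rw [cross_eq_zero_iff_eq_smul hx]
  conv_lhs => rw [← norm_smul_vorticityDirection ω x]
  rw [map_smul, real_inner_smul_left, real_inner_smul_right, norm_smul, Real.norm_eq_abs,
    abs_of_nonneg (norm_nonneg _), norm_vorticityDirection ω hx, mul_one, smul_smul]
  have h3 : ‖ω x‖ * (‖ω x‖ *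
      ⟪vorticityDirection ω x, A (vorticityDirection ω x)⟫) / ‖ω x‖ ^ 2 * ‖ω x‖ =
      ‖ω x‖ * ⟪vorticityDirection ω x, A (vorticityDirection ω x)⟫ := by
    field_simp
  rw [h3, ← smul_smul]
  exact (smul_right_injective _ hr).eq_iff

end VorticityDirectionDynamics

end Literature.Analysis.FluidPDE
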